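import Summits.FinalStateConjecture.FinalStateConjecture.Theses.EIHFluxBalance
import Summits.FinalStateConjecture.FinalStateConjecture.Theorems.InertialRecession.Negative.KinematicShadow
import Summits.FinalStateConjecture.FinalStateConjecture.Theorems.InertialRecession.Negative.PaintingRigidityStabiliser
import Summits.FinalStateConjecture.FinalStateConjecture.Theorems.InertialRecession.Negative.CesaroShadow

/-!
# Line `old-light-leaves-the-cone` — skeleton for the crux `InertialRecession`
# (item stmt-FinalStateConjecture-10166, route EIHFluxBalance) — SECOND-LEAD RESHAPE r1 (2026-08-16)

Planner skeleton: `planner-cruxplan-stmt-FinalStateConjecture-10166-old-light-leaves-the-0` / gen-2 seat (5 stubs,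
registered sha 60c11662bd88). Second line lead: `prover-line-stmt-FinalStateConjecture-10166-b-0` (the first lead,
`prover-line-stmt-FinalStateConjecture-10166-0`, runs the sibling line `sublinear-is-free-clean-window-charges`).
Cards: `Ideas/old-light-leaves-the-cone.md`, `Lines/old-light-leaves-the-cone.md`, `PICKED.md` (second section).

## The line in one paragraph (unchanged idea)

The weighted clause of the hypothesis lives on the SOLID cone `|x̲| ≤ κt` at all late times; every outgoing (incoming)
null ray through a sphere inside the middle cone `|x̲| ≤ (κ+κ²)t/2` meets the zone `d ≍ t` where the weight `1 + d^{7/4}`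
is largest, later (earlier), so the `m ≤ 3` weighted sup bounds become a retarded/advanced RATE `o(u^{-3/4})` for
everything radiative: ONE `L¹(dt)` luminosity majorant for the radiative curvature flux through EVERY admissible window
(S1, gauge- and painting-free, on the curvature of the lab metric). Fed — at the metric level, in a late radiation gauge —
into the Landau–Lifshitz balance on moving δ-clear coordinate spheres this gives QUASI-CONSERVATION of window charges with
the EIH-size exchange `C∫(R⁻² + R^{-7/4})` and an `o(1)` slack (S2, hardest). Identification of single-hole charges with
`Mᵢγᵢ(1,vᵢ)` + additivity (S3b) and the kinematics of the painted velocities (S3a) turn the moduli into an "expanding system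
of charges", whose soft final-motion lemma (S4, Mathlib-only) yields the CESÀRO velocities that the shared re-charting
transfer (S5) consumes.

## Reshape r1 (second lead) — what changed against the planner's skeleton (sha 60c11662bd88) and why

* Every registered stub is SELF-CONTAINED: the planner's local `def`s (`Hyp`, `labMetric`, `modulatedBackground`,
  `riemNormSq`, `labVelocity`, `lorentzFactor`, `IsWindow`, `CurvatureLuminosity`, `WindowLaw`, `Slaving`,
  `ChargeIdentification`) are inlined verbatim, because a Theorems-side proof must restate the stub literally (the gate
  matches `--supports` files to registered stubs by name + signature) and Prop-valued definitions cannot live under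
  `Summits/…/Theorems` (the audit classes them `vendored-fact`). The lab metric and the painted lab velocity are spelled
  EXACTLY as in the sibling line's reshaped skeleton (`(fun x : E4 ↦ (Minkowski.bilin + Σ …) + deviationExtend ⟨U,…⟩ Φ x)`,
  `((Λe₀)⁰)⁻¹ • spatial(Λe₀)`), so sub-lemmas about these two objects are shareable byte-for-byte.
* S3 is split (total 6 ≤ stubs_max 7): `stub_paintedVelocityKinematics` (S3a: continuity of `t ↦ v(Λᵢ(t)e₀)` and a uniform
  bound `k < 1` — pure Lorentz-group kinematics, provable now from `Theorems.EIHFluxBalanceInertialRecessionLorentz` /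
  `…LabVelocity`) and `stub_slavingChargeIdentification` (S3b: `ξ̇ᵢ − vᵢ → 0` via the constraint equations, plus the LL
  charge identification/additivity — the GR content).
* S4 `stub_expandingChargeKinematics` now concludes with what S5 actually consumes — CESÀRO velocities
  `t⁻¹ • ξᵢ(t) → Vᵢ` — instead of instantaneous limits of the painted velocities (the planner's docstring: "this line
  feeds S5 MORE than it needs"). Reasons: (i) the composition needs nothing more; (ii) with the slack-form budget
  `C∫(R⁻² + R^{-7/4}) + η(t₁)` the per-hole impulse available over `[t, 2t]` at a sub-`t^{4/7}` partner distance is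
  unbounded, so an INSTANTANEOUS limit for such a hole is not derivable from the typed hypotheses alone (Disproof §H,
  Tauberian remark: `|ξ''| ≲ d^{-7/4} ≤ B/t ⇔ d ≳ t^{4/7}`), while the Cesàro limit follows from the crossing mechanism at
  exponent `p = 7/4 > 1` (`Negative/CleanScaleCesaro`, sharp at `p = 1`); (iii) the lead (this seat) holds S4 and wants the
  statement whose truth does not hinge on an unrecorded Tauberian gap. The hypotheses of S4 are unchanged (they are what
  S2/S3 deliver), with `Slaving` unbundled into its three clauses.
* The helper `tendsto_inv_smul_of_tendsto_deriv` (instantaneous ⇒ Cesàro) is no longer needed by the composition and is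
  dropped from the skeleton (it stays in the tree's history of this file, gen 2).

## Stubs (6) and composition

* `stub_coneTransportLuminosity`      S1  — antecedent ⇒ curvature luminosity of the lab metric (the lever; L).
* `stub_windowFluxLaw`                S2  — antecedent + S1 ⇒ window law for `quasiLocalMomentum (labMetric)` (XL, hardest;
                                             delegated with an honest brief — expected `stub-blocked: LLBalanceLaw (10189)`).
* `stub_paintedVelocityKinematics`    S3a — antecedent ⇒ continuity + uniform subluminal bound of the painted velocities (S).
* `stub_slavingChargeIdentification`  S3b — antecedent ⇒ slaving `ξ̇ᵢ − vᵢ → 0` ∧ charge identification/additivity (L).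
* `stub_expandingChargeKinematics`    S4  — Mathlib-only: kinematics + slaving + window law + identification ⇒ Cesàro
                                             velocities (L; LEAD'S STUB).
* `stub_cesaroRecharting`             S5  — antecedent + Cesàro velocities ⇒ the crux conclusion (shared transfer; L/XL).
* `InertialRecession_of : InertialRecession` — the composition (pure logic; every `sorry` lives in a `stub_*`).

## Disproof.lean obligations honoured (re-read 2026-08-16T04Z, cycle-2 final, commit 8a42abad7307)

`inertialRecession_false_without_fieldEquations` / `_cesaro` (§C/§G, `Negative/KinematicShadow`, `Negative/CesaroShadow`):
the field equations enter through `𝒟` in S1 (Bianchi transport), S2 (LL balance on vacuum spheres) and S3b (constraints,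
shell identity); S4 derives Cesàro velocities from the conservation laws it is handed, never from kinematics — the §C/§G
witness `ξ = κ²∫cos(log(1+s²)/2)` violates the window law on its own isolated window `R = c₀t` (charge not Cauchy). §D
(`quadraticRemainder_not_integrable`): the junk/outgoing parts are booked by structure in S2, the incoming part carries the
transported rate (`_integrable_of_rate`, δ = 3/4). §H (`Negative/CleanScaleCesaro`, `…Sharpness`, `…TwoBody`, `…Encounters`,
`…Tauberian`): now the MECHANISM of S4 (exponent `7/4 > 1`; the landed toy lemmas are imported by the S4 work file).
`PaintingRigidityStabiliser`: no stub mentions `deriv Λᵢ`; boosts enter only through the lab velocity of `Λᵢ(t)e₀`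
(twist-invariant, `R_z e₀ = e₀`) and through the lab metric (painting-free). §B (`N = 0`) sits inside S5
(`Theorems.inertialRecession_noHoles`, p68340). §E r2 (lab-slab/boosted-slab exhaustion transfer; prover seat 0's
"causal convexity" obstruction note on the item, 2026-08-16T03:24Z) is S5's declared risk and is in the S5 brief.
-/

set_option linter.dupNamespace false
set_option linter.unusedVariables false

noncomputable section

namespace Summit.FinalStateConjecture.FinalStateConjecture.Cruxes.InertialRecession.OldLightLeavesTheCone

open scoped BigOperators Topology Manifold Classical MeasureTheory Matrix InnerProductSpace ContDiff ENNReal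
open Filter Set Function TopologicalSpace MeasureTheory Literature.Geometry.Lorentzian
open Summit.FinalStateConjecture.FinalStateConjecture.Theses.EIHFluxBalance

/-! ## The six registered stubs (every signature self-contained) -/

/-- **S1 — THE LEVER: old light leaves the cone (cone transport ⇒ universal `L¹` curvature luminosity).**
Under the crux antecedent, for every clearance `δ ∈ (0,1)` there are `C, R₀, T` and ONE `ℓ ∈ L¹(T, ∞)` such that
through every admissible window sphere `S(c, R)` at lab time `t ≥ T` (`R ≥ R₀`, `‖c‖ + R ≤ (κ+κ²)t/2`, every painted
centre within `(1−δ)R` or beyond `(1+δ)R` of `c`) the coordinate curvature flux of the LAB METRIC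
`gLab = (η + Σᵢ(boosted KS − η)) + deviationExtend` (= `Φ^*g` on `U`, painting-free) is `≤ C/R⁴ + ℓ(t)`: Coulomb part
`|Riem| ≲ M/(δR)³` squared × area, radiative part = the `m = 2,3` weighted clauses READ AT THE CONE-EXIT POINT of the
outgoing ray (distance `≥ (κ−κ²)t*` from every centre, valid for every `κ < 1`) resp. the entry point for incoming light,
transported by Bianchi / Bel–Robinson `r^p` identities on truncated cones `{u = const} ∩ {|x̲| ≤ κt}` (arXiv:0910.4957,
arXiv:1509.08495); `∫_S r_j^{-2}dσ ≤ C_δ` makes `ℓ` uniform in `(c, R)`. Scalar `ℓ = 0` model = the idea card's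
`ConeTransportRate` (triage K4/F-g/F3: true). CAVEAT (S1 → S2 is not a black box): the bound certifies the rate at
CURVATURE level only. [size L] -/
theorem stub_coneTransportLuminosity :
    ∀ (X : Type) [TopologicalSpace X] [ChartedSpace E3 X] [IsManifold (𝓡 3) ((⊤ : ℕ∞) : WithTop ℕ∞) X] [T2Space X] [SecondCountableTopology X] [ConnectedSpace X], ∀ D ∈ admissibleVacuumData X, ∀ 𝒟 : VacuumCauchyDevelopment D, 𝒟.IsMaximal → ∀ (N : ℕ) (M a rin : Fin N → ℝ) (Λ : Fin N → ℝ → lorentzGroup) (ξ : Fin N → ℝ → E3) (γ κ τ₀ : ℝ) (U : Opens E4) (Φ : U → 𝒟.carrier) (O : Set 𝒟.carrier), ((∀ i, Kerr.IsSubextremal (M i) (a i) ∧ Kerr.rMinus (M i) (a i) < rin i ∧ rin i < Kerr.rPlus (M i) (a i)) ∧ (∀ i t, |((Λ i t : E4 ≃L[ℝ] E4) (E4.basisVector 0)) 0| ≤ γ) ∧ (∀ i, ContDiff ℝ ((⊤ : ℕ∞) : WithTop ℕ∞) (ξ i) ∧ ContDiff ℝ ((⊤ : ℕ∞) : WithTop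 ℕ∞) (fun t ↦ ((Λ i t : E4 ≃L[ℝ] E4) : E4 →L[ℝ] E4))) ∧ (∀ i j, i ≠ j → Tendsto (fun t ↦ ‖ξ i t - ξ j t‖) atTop atTop) ∧ (0 < κ ∧ κ < 1 ∧ ∀ i, ∀ᶠ t in atTop, ‖ξ i t‖ ≤ κ ^ 2 * t) ∧ ({x : E4 | τ₀ < x 0 ∧ ∀ i, rin i < Kerr.radius (a i) (poincareInv (Λ i (x 0)) (E4.ofTimeSpace (x 0) (ξ i (x 0))) x)} ⊆ (U : Set E4)) ∧ let B : ModelBackground := ⟨U, fun x ↦ Minkowski.bilin + ∑ i, (boostedKerrBilin (Λ i (x 0)) (E4.ofTimeSpace (x 0) (ξ i (x 0))) (M i) (a i) x - Minkowski.bilin), fun x ↦ x 0, E4.spatialNorm⟩; ContMDiff 𝓘(ℝ, E4) (𝓡 4) ((⊤ : ℕ∞) : WithTop ℕ∞) Φ ∧ Topology.IsOpenEmbedding ((B.lateRegion τ₀).restrict Φ) ∧ Φ '' {x : U | τ₀ < x.1 0 ∧ ∀ i, Kerr.rPlus (M i) (a i) < Kerr.radius (a i) (poincareInv (Λ i (x.1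 0)) (E4.ofTimeSpace (x.1 0) (ξ i (x.1 0))) x.1)} ⊆ O ∧ Tendsto (fun t ↦ 𝒟.toSpacetime.deviationCk B Φ 3 t) atTop (𝓝 0) ∧ Tendsto (fun t : ℝ ↦ ⨆ x ∈ {x : U | x.1 0 = t ∧ E4.spatialNorm x.1 ≤ κ * t}, ⨆ (m : ℕ) (_ : m ≤ 3), ENNReal.ofReal (1 + √(√((⨅ i, ‖E4.spatial x.1 - ξ i t‖) ^ 7))) * ‖iteratedFDeriv ℝ m (𝒟.toSpacetime.deviationExtend B Φ) x.1‖ₑ) atTop (𝓝 0) ∧ O = Summit.FinalStateConjecture.exteriorOf 𝒟.toCauchyDevelopment (Φ '' {x : U | τ₀ < x.1 0 ∧ ∀ i, Kerr.rPlus (M i) (a i) < Kerr.radius (a i) (poincareInv (Λ i (x.1 0)) (E4.ofTimeSpace (x.1 0) (ξ i (x.1 0))) x.1)}) ∧ ∀ t₁ : ℝ, τ₀ < t₁ → O \ Φ '' {x : U | t₁ < x.1 0 ∧ ∀ i, Kerr.rPlus (M i) (a i) < Kerr.radius (a i) (poincareInv (Λ i (x.1 0)) (E4.ofTimeSpace (x.1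 0) (ξ i (x.1 0))) x.1)} ⊆ 𝒟.metric.causalPast 𝒟.timeOrientation (Φ '' {x : U | x.1 0 = t₁ ∧ ∀ i, Kerr.rPlus (M i) (a i) < Kerr.radius (a i) (poincareInv (Λ i (x.1 0)) (E4.ofTimeSpace (x.1 0) (ξ i (x.1 0))) x.1)})) →
      ∀ δ : ℝ, 0 < δ → δ < 1 → ∃ (C R₀ T : ℝ) (ℓ : ℝ → ℝ), IntegrableOn ℓ (Set.Ioi T) ∧ ∀ (t : ℝ) (c : E3) (R : ℝ), T ≤ t → (R₀ ≤ R ∧ ‖c‖ + R ≤ (κ + κ ^ 2) / 2 * t ∧ ∀ j, ‖ξ j t - c‖ ≤ (1 - δ) * R ∨ (1 + δ) * R ≤ ‖ξ j t - c‖) → ∫ y in Metric.sphere c R, (∑ μ : Fin 4, ∑ ν : Fin 4, ∑ α : Fin 4, ∑ β : Fin 4, (MetricCoord.riemAt (fun x : E4 ↦ (Minkowski.bilin + ∑ i, (boostedKerrBilin (Λ i (x 0)) (E4.ofTimeSpace (x 0) (ξ i (x 0))) (M i) (a i) x - Minkowski.bilin)) + 𝒟.toSpacetime.deviationExtend (⟨U,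 fun x ↦ Minkowski.bilin + ∑ i, (boostedKerrBilin (Λ i (x 0)) (E4.ofTimeSpace (x 0) (ξ i (x 0))) (M i) (a i) x - Minkowski.bilin), fun x ↦ x 0, E4.spatialNorm⟩ : ModelBackground) Φ x) (E4.ofTimeSpace t y) (E4.basisVector μ) (E4.basisVector ν) (E4.basisVector α) β) ^ 2) ∂(μHE[2] : Measure E3) ≤ C / R ^ 4 + ℓ t := by
  sorry

/-- **S2 — WINDOW FLUX LAW (LL balance + 1PM exchange + transported rate ⇒ quasi-conservation of window charges;
HARDEST).** Under the antecedent and granted S1's curvature luminosity: for every `δ ∈ (0,1)` there are `C, R₀, T` and a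
slack `η → 0` such that along every `2`-Lipschitz path of admissible windows on `[t₁, t₂] ⊆ [T, ∞)` the Landau–Lifshitz
four-momentum `P = quasiLocalMomentum gLab` changes by at most `C∫(R⁻² + R^{-7/4}) + η(t₁)`. Mechanism:
`dP/dt = −∮(−g)(t^{μk} − t^{μ0}v_S^k)n_k` exactly on moving vacuum spheres (route support `LLBalanceLaw`,
stmt-FinalStateConjecture-10189 (iii) + transport theorem; quadratic in `∂𝔤`); pointwise flux
`≤ C(M²R⁻² + MεR^{-7/4} + ε²R^{-3/2})` — 1PM exchange (route informal `EIHFluxEvaluation`, 10188) and the `G × ∂h` cross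
term are in the budget; the `hh` term is handled by STRUCTURE in a late radiation gauge built from sup-norm data:
(a) incoming radiation carries the advanced rate (flux `o(t^{-3/2}) ∈ L¹`), (b) outgoing radiation is a BUDGET by positivity
of its LL energy flux (`P⁰ ≥ ΣMⱼ − o(1)`), (c) gauge junk of the critical size `εR^{-7/4}` enters `P` only through an `o(1)`
state function (telescopes into `η(t₁)`). [size XL; foreseen split S2a gauge, S2b metric-level transport, S2c bookkeeping;
cites LL §96 (96.8)–(96.16), arXiv:1310.1528 §2, doi:10.2307/1968714, doi:10.1103/PhysRevD.31.1815, arXiv:gr-qc/9910052] -/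
theorem stub_windowFluxLaw :
    ∀ (X : Type) [TopologicalSpace X] [ChartedSpace E3 X] [IsManifold (𝓡 3) ((⊤ : ℕ∞) : WithTop ℕ∞) X] [T2Space X] [SecondCountableTopology X] [ConnectedSpace X], ∀ D ∈ admissibleVacuumData X, ∀ 𝒟 : VacuumCauchyDevelopment D, 𝒟.IsMaximal → ∀ (N : ℕ) (M a rin : Fin N → ℝ) (Λ : Fin N → ℝ → lorentzGroup) (ξ : Fin N → ℝ → E3) (γ κ τ₀ : ℝ) (U : Opens E4) (Φ : U → 𝒟.carrier) (O : Set 𝒟.carrier), ((∀ i, Kerr.IsSubextremal (M i) (a i) ∧ Kerr.rMinus (M i) (a i) < rin i ∧ rin i < Kerr.rPlus (M i) (a i)) ∧ (∀ i t, |((Λ i t : E4 ≃L[ℝ] E4) (E4.basisVector 0)) 0| ≤ γ) ∧ (∀ i, ContDiff ℝ ((⊤ : ℕ∞) : WithTop ℕ∞) (ξ i) ∧ ContDiff ℝ ((⊤ : ℕ∞) : WithTop ℕ∞) (fun t ↦ ((Λ i t : E4 ≃L[ℝ] E4) : E4 →L[ℝ] E4))) ∧ (∀ i j, i ≠ j →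 Tendsto (fun t ↦ ‖ξ i t - ξ j t‖) atTop atTop) ∧ (0 < κ ∧ κ < 1 ∧ ∀ i, ∀ᶠ t in atTop, ‖ξ i t‖ ≤ κ ^ 2 * t) ∧ ({x : E4 | τ₀ < x 0 ∧ ∀ i, rin i < Kerr.radius (a i) (poincareInv (Λ i (x 0)) (E4.ofTimeSpace (x 0) (ξ i (x 0))) x)} ⊆ (U : Set E4)) ∧ let B : ModelBackground := ⟨U, fun x ↦ Minkowski.bilin + ∑ i, (boostedKerrBilin (Λ i (x 0)) (E4.ofTimeSpace (x 0) (ξ i (x 0))) (M i) (a i) x - Minkowski.bilin), fun x ↦ x 0, E4.spatialNorm⟩; ContMDiff 𝓘(ℝ, E4) (𝓡 4) ((⊤ : ℕ∞) : WithTop ℕ∞) Φ ∧ Topology.IsOpenEmbedding ((B.lateRegion τ₀).restrict Φ) ∧ Φ '' {x : U | τ₀ < x.1 0 ∧ ∀ i, Kerr.rPlus (M i) (a i) < Kerr.radius (a i) (poincareInv (Λ i (x.1 0)) (E4.ofTimeSpace (x.1 0) (ξ i (x.1 0))) x.1)} ⊆ O ∧ Tendsto (fun t ↦ 𝒟.toSpacetime.deviationCk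 B Φ 3 t) atTop (𝓝 0) ∧ Tendsto (fun t : ℝ ↦ ⨆ x ∈ {x : U | x.1 0 = t ∧ E4.spatialNorm x.1 ≤ κ * t}, ⨆ (m : ℕ) (_ : m ≤ 3), ENNReal.ofReal (1 + √(√((⨅ i, ‖E4.spatial x.1 - ξ i t‖) ^ 7))) * ‖iteratedFDeriv ℝ m (𝒟.toSpacetime.deviationExtend B Φ) x.1‖ₑ) atTop (𝓝 0) ∧ O = Summit.FinalStateConjecture.exteriorOf 𝒟.toCauchyDevelopment (Φ '' {x : U | τ₀ < x.1 0 ∧ ∀ i, Kerr.rPlus (M i) (a i) < Kerr.radius (a i) (poincareInv (Λ i (x.1 0)) (E4.ofTimeSpace (x.1 0) (ξ i (x.1 0))) x.1)}) ∧ ∀ t₁ : ℝ, τ₀ < t₁ → O \ Φ '' {x : U | t₁ < x.1 0 ∧ ∀ i, Kerr.rPlus (M i) (a i) < Kerr.radius (a i) (poincareInv (Λ i (x.1 0)) (E4.ofTimeSpace (x.1 0) (ξ i (x.1 0))) x.1)} ⊆ 𝒟.metric.causalPast 𝒟.timeOrientation (Φ '' {x : U | x.1 0 = t₁ ∧ ∀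 i, Kerr.rPlus (M i) (a i) < Kerr.radius (a i) (poincareInv (Λ i (x.1 0)) (E4.ofTimeSpace (x.1 0) (ξ i (x.1 0))) x.1)})) →
      (∀ δ : ℝ, 0 < δ → δ < 1 → ∃ (C R₀ T : ℝ) (ℓ : ℝ → ℝ), IntegrableOn ℓ (Set.Ioi T) ∧ ∀ (t : ℝ) (c : E3) (R : ℝ), T ≤ t → (R₀ ≤ R ∧ ‖c‖ + R ≤ (κ + κ ^ 2) / 2 * t ∧ ∀ j, ‖ξ j t - c‖ ≤ (1 - δ) * R ∨ (1 + δ) * R ≤ ‖ξ j t - c‖) → ∫ y in Metric.sphere c R, (∑ μ : Fin 4, ∑ ν : Fin 4, ∑ α : Fin 4, ∑ β : Fin 4, (MetricCoord.riemAt (fun x : E4 ↦ (Minkowski.bilin + ∑ i, (boostedKerrBilin (Λ i (x 0)) (E4.ofTimeSpace (x 0) (ξ i (x 0))) (M i) (a i) x - Minkowski.bilin)) + 𝒟.toSpacetime.deviationExtend (⟨U, fun x ↦ Minkowski.bilin + ∑ i, (boostedKerrBilin (Λ i (x 0)) (E4.ofTimeSpace (x 0) (ξ i (x 0))) (M i)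 (a i) x - Minkowski.bilin), fun x ↦ x 0, E4.spatialNorm⟩ : ModelBackground) Φ x) (E4.ofTimeSpace t y) (E4.basisVector μ) (E4.basisVector ν) (E4.basisVector α) β) ^ 2) ∂(μHE[2] : Measure E3) ≤ C / R ^ 4 + ℓ t) →
      ∀ δ : ℝ, 0 < δ → δ < 1 → ∃ (C R₀ T : ℝ) (η : ℝ → ℝ), Tendsto η atTop (𝓝 0) ∧ ∀ (t₁ t₂ : ℝ) (c : ℝ → E3) (R : ℝ → ℝ), T ≤ t₁ → t₁ ≤ t₂ → (∀ s ∈ Set.Icc t₁ t₂, ∀ s' ∈ Set.Icc t₁ t₂, ‖c s - c s'‖ ≤ 2 * |s - s'| ∧ |R s - R s'| ≤ 2 * |s - s'|) → (∀ s ∈ Set.Icc t₁ t₂, (R₀ ≤ R s ∧ ‖c s‖ + R s ≤ (κ + κ ^ 2) / 2 * s ∧ ∀ j, ‖ξ j s - c s‖ ≤ (1 - δ) * R s ∨ (1 + δ) * R s ≤ ‖ξ j s - c s‖)) → ∀ μ : Fin 4, |LandauLifshitz.quasiLocalMomentum (fun x : E4 ↦ (Minkowski.bilin + ∑ i, (boostedKerrBilin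 (Λ i (x 0)) (E4.ofTimeSpace (x 0) (ξ i (x 0))) (M i) (a i) x - Minkowski.bilin)) + 𝒟.toSpacetime.deviationExtend (⟨U, fun x ↦ Minkowski.bilin + ∑ i, (boostedKerrBilin (Λ i (x 0)) (E4.ofTimeSpace (x 0) (ξ i (x 0))) (M i) (a i) x - Minkowski.bilin), fun x ↦ x 0, E4.spatialNorm⟩ : ModelBackground) Φ x) t₂ (c t₂) (R t₂) μ - LandauLifshitz.quasiLocalMomentum (fun x : E4 ↦ (Minkowski.bilin + ∑ i, (boostedKerrBilin (Λ i (x 0)) (E4.ofTimeSpace (x 0) (ξ i (x 0))) (M i) (a i) x - Minkowski.bilin)) + 𝒟.toSpacetime.deviationExtend (⟨U, fun x ↦ Minkowski.bilin + ∑ i, (boostedKerrBilin (Λ i (x 0)) (E4.ofTimeSpace (x 0) (ξ i (x 0))) (M i) (a i) x - Minkowski.bilin), fun x ↦ x 0, E4.spatialNorm⟩ : ModelBackground) Φ x) t₁ (c t₁) (R t₁) μ| ≤ C * (∫ s in t₁..t₂, ((R s) ^ 2)⁻¹ + ((R s) ^ (7 / 4 : ℝ))⁻¹) + η t₁ :=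 by
  sorry

/-- **S3a — KINEMATICS OF THE PAINTED VELOCITIES (Lorentz-group bookkeeping).** Under the antecedent the painted lab
velocities `vᵢ(t) = ((Λᵢ(t)e₀)⁰)⁻¹ (Λᵢ(t)e₀)~` are continuous in `t` (`Λᵢ` is smooth as a `CLM`-valued map and
`|(Λe₀)⁰| ≥ 1`, `Theorems.one_le_abs_lorentz_apply_zero`) and uniformly subluminal: `‖vᵢ(t)‖ ≤ k := √(1 − γ⁻²) < 1` from
the Lorentz clause `|(Λᵢ(t)e₀)⁰| ≤ γ` and `((Λe₀)⁰)² = 1 + ‖(Λe₀)~‖²` (`Theorems.lorentz_apply_zero_sq`,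
`Theorems.norm_labVelocity_sq_le` for the orthochronous sign; the formula is invariant under `u ↦ −u`). [size S] -/
theorem stub_paintedVelocityKinematics :
    ∀ (X : Type) [TopologicalSpace X] [ChartedSpace E3 X] [IsManifold (𝓡 3) ((⊤ : ℕ∞) : WithTop ℕ∞) X] [T2Space X] [SecondCountableTopology X] [ConnectedSpace X], ∀ D ∈ admissibleVacuumData X, ∀ 𝒟 : VacuumCauchyDevelopment D, 𝒟.IsMaximal → ∀ (N : ℕ) (M a rin : Fin N → ℝ) (Λ : Fin N → ℝ → lorentzGroup) (ξ : Fin N → ℝ → E3) (γ κ τ₀ : ℝ) (U : Opens E4) (Φ : U → 𝒟.carrier) (O : Set 𝒟.carrier), ((∀ i, Kerr.IsSubextremal (M i) (a i) ∧ Kerr.rMinus (M i) (a i) < rin i ∧ rin i < Kerr.rPlus (M i) (a i)) ∧ (∀ i t, |((Λ i t : E4 ≃L[ℝ] E4) (E4.basisVector 0)) 0| ≤ γ) ∧ (∀ i, ContDiff ℝ ((⊤ : ℕ∞) : WithTop ℕ∞) (ξ i) ∧ ContDiff ℝ ((⊤ : ℕ∞) : WithTop ℕ∞) (fun t ↦ ((Λ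 i t : E4 ≃L[ℝ] E4) : E4 →L[ℝ] E4))) ∧ (∀ i j, i ≠ j → Tendsto (fun t ↦ ‖ξ i t - ξ j t‖) atTop atTop) ∧ (0 < κ ∧ κ < 1 ∧ ∀ i, ∀ᶠ t in atTop, ‖ξ i t‖ ≤ κ ^ 2 * t) ∧ ({x : E4 | τ₀ < x 0 ∧ ∀ i, rin i < Kerr.radius (a i) (poincareInv (Λ i (x 0)) (E4.ofTimeSpace (x 0) (ξ i (x 0))) x)} ⊆ (U : Set E4)) ∧ let B : ModelBackground := ⟨U, fun x ↦ Minkowski.bilin + ∑ i, (boostedKerrBilin (Λ i (x 0)) (E4.ofTimeSpace (x 0) (ξ i (x 0))) (M i) (a i) x - Minkowski.bilin), fun x ↦ x 0, E4.spatialNorm⟩; ContMDiff 𝓘(ℝ, E4) (𝓡 4) ((⊤ : ℕ∞) : WithTop ℕ∞) Φ ∧ Topology.IsOpenEmbedding ((B.lateRegion τ₀).restrict Φ) ∧ Φ '' {x : U | τ₀ < x.1 0 ∧ ∀ i, Kerr.rPlus (M i) (a i) < Kerr.radius (a i) (poincareInv (Λ i (x.1 0)) (E4.ofTimeSpace (x.1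 0) (ξ i (x.1 0))) x.1)} ⊆ O ∧ Tendsto (fun t ↦ 𝒟.toSpacetime.deviationCk B Φ 3 t) atTop (𝓝 0) ∧ Tendsto (fun t : ℝ ↦ ⨆ x ∈ {x : U | x.1 0 = t ∧ E4.spatialNorm x.1 ≤ κ * t}, ⨆ (m : ℕ) (_ : m ≤ 3), ENNReal.ofReal (1 + √(√((⨅ i, ‖E4.spatial x.1 - ξ i t‖) ^ 7))) * ‖iteratedFDeriv ℝ m (𝒟.toSpacetime.deviationExtend B Φ) x.1‖ₑ) atTop (𝓝 0) ∧ O = Summit.FinalStateConjecture.exteriorOf 𝒟.toCauchyDevelopment (Φ '' {x : U | τ₀ < x.1 0 ∧ ∀ i, Kerr.rPlus (M i) (a i) < Kerr.radius (a i) (poincareInv (Λ i (x.1 0)) (E4.ofTimeSpace (x.1 0) (ξ i (x.1 0))) x.1)}) ∧ ∀ t₁ : ℝ, τ₀ < t₁ → O \ Φ '' {x : U | t₁ < x.1 0 ∧ ∀ i, Kerr.rPlus (M i) (a i) < Kerr.radius (a i) (poincareInv (Λ i (x.1 0)) (E4.ofTimeSpace (x.1 0) (ξ i (x.1 0))) x.1)}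 ⊆ 𝒟.metric.causalPast 𝒟.timeOrientation (Φ '' {x : U | x.1 0 = t₁ ∧ ∀ i, Kerr.rPlus (M i) (a i) < Kerr.radius (a i) (poincareInv (Λ i (x.1 0)) (E4.ofTimeSpace (x.1 0) (ξ i (x.1 0))) x.1)})) →
      (∀ i, Continuous (fun t ↦ (((((Λ i t : lorentzGroup) : E4 ≃L[ℝ] E4) (E4.basisVector 0)) 0)⁻¹ • E4.spatial (((Λ i t : lorentzGroup) : E4 ≃L[ℝ] E4) (E4.basisVector 0))))) ∧ (∃ k : ℝ, 0 ≤ k ∧ k < 1 ∧ ∀ i, ∀ᶠ t in atTop, ‖(((((Λ i t : lorentzGroup) : E4 ≃L[ℝ] E4) (E4.basisVector 0)) 0)⁻¹ • E4.spatial (((Λ i t : lorentzGroup) : E4 ≃L[ℝ] E4) (E4.basisVector 0)))‖ ≤ k) := by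
  sorry

/-- **S3b — SLAVING AND CHARGE IDENTIFICATION (the GR half of the planner's S3).** Under the antecedent:
(slaving) `ξ̇ᵢ − vᵢ → 0`, from `C³`-closeness to the modulated ansatz near the horizon WITHOUT an a-priori bound on the
painted jet — the vacuum CONSTRAINT equations of `Φ^*g = G(λ(t)) + h` on lab slices see `(λ, λ̇)` only,
`𝒞[G(λ), ∂ₜG] = 𝒞₁(λ)[λ̇_⊥] + 𝒞₂(λ)[λ̇_⊥, λ̇_⊥] = O(δ(t)(1 + |λ̇_⊥|²))`, `δ → 0`, `𝒞₁` injective modulo the Kerr–Schild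
stabiliser (kit j005733, `a = 0`), so `λ̇_⊥ → 0` by continuity; only its translation part is exported;
(identification) there are `C, R₀, T` and `ζ → 0` such that (i) a sphere around ONE hole (others `≥ 3R` away, inside the
middle cone) carries `Mᵢγ(vᵢ)(1, vᵢ)` up to `ζ(t) + C/R` — exact Kerr–Schild charge of the boosted hole at a slowly
growing inner radius (drefute's free gift: `emComplex[KS] ≡ 0`, so `γM(1,v)` on ANY enclosing sphere of the frozen
hole) plus the VACUUM SHELL IDENTITY, quadratic in `∂g` (cross `o(R₀^{-3/4})`, `hh` `o(R₀^{-1/2})`, other holes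
`≤ CMᵢMⱼ/D ≤ C/R`); (ii) ADDITIVITY on windows (members within `R/2`, others beyond `2R`, member spheres `ρⱼ ≤ R/4`,
`3ρⱼ ≤ Dⱼⱼ'`): perforated Gauss, interaction field momenta `∫d³x/(r_j²r_k²) ≤ C/ρ`. Charges of the TRUE lab metric
(inner spheres + Gauss, never the outer painted sphere: painted rates add `c′MRu′` to the momentum components of `P[G]`).
[size L; LL §96 (96.16)–(96.17); doi:10.1007/BF02105068 (KS energy); card scale-t-static-sphere-charges] -/
theorem stub_slavingChargeIdentification :
    ∀ (X : Type) [TopologicalSpace X] [ChartedSpace E3 X] [IsManifold (𝓡 3) ((⊤ : ℕ∞) : WithTop ℕ∞) X] [T2Space X] [SecondCountableTopology X] [ConnectedSpace X], ∀ D ∈ admissibleVacuumData X, ∀ 𝒟 : VacuumCauchyDevelopment D, 𝒟.IsMaximal → ∀ (N : ℕ) (M a rin : Fin N → ℝ) (Λ : Fin N → ℝ → lorentzGroup) (ξ : Fin N → ℝ → E3) (γ κ τ₀ : ℝ) (U : Opens E4) (Φ : U → 𝒟.carrier) (O : Set 𝒟.carrier), ((∀ i, Kerr.IsSubextremal (M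 i) (a i) ∧ Kerr.rMinus (M i) (a i) < rin i ∧ rin i < Kerr.rPlus (M i) (a i)) ∧ (∀ i t, |((Λ i t : E4 ≃L[ℝ] E4) (E4.basisVector 0)) 0| ≤ γ) ∧ (∀ i, ContDiff ℝ ((⊤ : ℕ∞) : WithTop ℕ∞) (ξ i) ∧ ContDiff ℝ ((⊤ : ℕ∞) : WithTop ℕ∞) (fun t ↦ ((Λ i t : E4 ≃L[ℝ] E4) : E4 →L[ℝ] E4))) ∧ (∀ i j, i ≠ j → Tendsto (fun t ↦ ‖ξ i t - ξ j t‖) atTop atTop) ∧ (0 < κ ∧ κ < 1 ∧ ∀ i, ∀ᶠ t in atTop, ‖ξ i t‖ ≤ κ ^ 2 * t) ∧ ({x : E4 | τ₀ < x 0 ∧ ∀ i, rin i < Kerr.radius (a i) (poincareInv (Λ i (x 0)) (E4.ofTimeSpace (x 0) (ξ i (x 0))) x)} ⊆ (U : Set E4)) ∧ let B : ModelBackground := ⟨U, fun x ↦ Minkowski.bilin + ∑ i, (boostedKerrBilin (Λ i (x 0)) (E4.ofTimeSpace (x 0) (ξ i (x 0))) (M i) (a i) x - Minkowski.bilin), fun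 x ↦ x 0, E4.spatialNorm⟩; ContMDiff 𝓘(ℝ, E4) (𝓡 4) ((⊤ : ℕ∞) : WithTop ℕ∞) Φ ∧ Topology.IsOpenEmbedding ((B.lateRegion τ₀).restrict Φ) ∧ Φ '' {x : U | τ₀ < x.1 0 ∧ ∀ i, Kerr.rPlus (M i) (a i) < Kerr.radius (a i) (poincareInv (Λ i (x.1 0)) (E4.ofTimeSpace (x.1 0) (ξ i (x.1 0))) x.1)} ⊆ O ∧ Tendsto (fun t ↦ 𝒟.toSpacetime.deviationCk B Φ 3 t) atTop (𝓝 0) ∧ Tendsto (fun t : ℝ ↦ ⨆ x ∈ {x : U | x.1 0 = t ∧ E4.spatialNorm x.1 ≤ κ * t}, ⨆ (m : ℕ) (_ : m ≤ 3), ENNReal.ofReal (1 + √(√((⨅ i, ‖E4.spatial x.1 - ξ i t‖) ^ 7))) * ‖iteratedFDeriv ℝ m (𝒟.toSpacetime.deviationExtend B Φ) x.1‖ₑ) atTop (𝓝 0) ∧ O = Summit.FinalStateConjecture.exteriorOf 𝒟.toCauchyDevelopment (Φ '' {x : U | τ₀ < x.1 0 ∧ ∀ i, Kerr.rPlus (M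 i) (a i) < Kerr.radius (a i) (poincareInv (Λ i (x.1 0)) (E4.ofTimeSpace (x.1 0) (ξ i (x.1 0))) x.1)}) ∧ ∀ t₁ : ℝ, τ₀ < t₁ → O \ Φ '' {x : U | t₁ < x.1 0 ∧ ∀ i, Kerr.rPlus (M i) (a i) < Kerr.radius (a i) (poincareInv (Λ i (x.1 0)) (E4.ofTimeSpace (x.1 0) (ξ i (x.1 0))) x.1)} ⊆ 𝒟.metric.causalPast 𝒟.timeOrientation (Φ '' {x : U | x.1 0 = t₁ ∧ ∀ i, Kerr.rPlus (M i) (a i) < Kerr.radius (a i) (poincareInv (Λ i (x.1 0)) (E4.ofTimeSpace (x.1 0) (ξ i (x.1 0))) x.1)})) →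
      (∀ i, Tendsto (fun t ↦ deriv (ξ i) t - (((((Λ i t : lorentzGroup) : E4 ≃L[ℝ] E4) (E4.basisVector 0)) 0)⁻¹ • E4.spatial (((Λ i t : lorentzGroup) : E4 ≃L[ℝ] E4) (E4.basisVector 0)))) atTop (𝓝 0)) ∧
      (∃ (C R₀ T : ℝ) (ζ : ℝ → ℝ), Tendsto ζ atTop (𝓝 0) ∧ (∀ (t : ℝ) (i : Fin N) (R : ℝ), T ≤ t → R₀ ≤ R → ‖ξ i t‖ + R ≤ (κ + κ ^ 2) / 2 * t → (∀ j, j ≠ i → 3 * R ≤ ‖ξ i t - ξ j t‖) → |LandauLifshitz.quasiLocalMomentum (fun x : E4 ↦ (Minkowski.bilin + ∑ i, (boostedKerrBilin (Λ i (x 0)) (E4.ofTimeSpace (x 0) (ξ i (x 0))) (M i) (a i) x - Minkowski.bilin)) + 𝒟.toSpacetime.deviationExtend (⟨U, fun x ↦ Minkowski.bilin + ∑ i, (boostedKerrBilin (Λ i (x 0)) (E4.ofTimeSpace (x 0) (ξ i (x 0))) (M i) (a i) x - Minkowski.bilin), fun x ↦ x 0, E4.spatialNorm⟩ : ModelBackground)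 Φ x) t (ξ i t) R 0 - M i * (√(1 - ‖(((((Λ i t : lorentzGroup) : E4 ≃L[ℝ] E4) (E4.basisVector 0)) 0)⁻¹ • E4.spatial (((Λ i t : lorentzGroup) : E4 ≃L[ℝ] E4) (E4.basisVector 0)))‖ ^ 2))⁻¹| ≤ ζ t + C / R ∧ ∀ k : Fin 3, |LandauLifshitz.quasiLocalMomentum (fun x : E4 ↦ (Minkowski.bilin + ∑ i, (boostedKerrBilin (Λ i (x 0)) (E4.ofTimeSpace (x 0) (ξ i (x 0))) (M i) (a i) x - Minkowski.bilin)) + 𝒟.toSpacetime.deviationExtend (⟨U, fun x ↦ Minkowski.bilin + ∑ i, (boostedKerrBilin (Λ i (x 0)) (E4.ofTimeSpace (x 0) (ξ i (x 0))) (M i) (a i) x - Minkowski.bilin), fun x ↦ x 0, E4.spatialNorm⟩ : ModelBackground) Φ x) t (ξ i t) R k.succ - M i * (√(1 - ‖(((((Λ i t : lorentzGroup) : E4 ≃L[ℝ] E4) (E4.basisVector 0)) 0)⁻¹ • E4.spatial (((Λ i t : lorentzGroup) : E4 ≃L[ℝ] E4) (E4.basisVector 0)))‖ ^ 2))⁻¹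 * (((((Λ i t : lorentzGroup) : E4 ≃L[ℝ] E4) (E4.basisVector 0)) 0)⁻¹ • E4.spatial (((Λ i t : lorentzGroup) : E4 ≃L[ℝ] E4) (E4.basisVector 0))) k| ≤ ζ t + C / R) ∧ (∀ (t : ℝ) (c : E3) (R : ℝ) (A : Finset (Fin N)) (ρ : Fin N → ℝ), T ≤ t → R₀ ≤ R → ‖c‖ + R ≤ (κ + κ ^ 2) / 2 * t → (∀ j ∈ A, ‖ξ j t - c‖ ≤ R / 2) → (∀ j ∉ A, 2 * R ≤ ‖ξ j t - c‖) → (∀ j ∈ A, R₀ ≤ ρ j ∧ ρ j ≤ R / 4 ∧ ∀ j', j' ≠ j → 3 * ρ j ≤ ‖ξ j t - ξ j' t‖) → ∀ μ : Fin 4, |LandauLifshitz.quasiLocalMomentum (fun x : E4 ↦ (Minkowski.bilin + ∑ i, (boostedKerrBilin (Λ i (x 0)) (E4.ofTimeSpace (x 0) (ξ i (x 0))) (M i) (a i) x - Minkowski.bilin)) + 𝒟.toSpacetime.deviationExtend (⟨U, fun x ↦ Minkowski.bilin + ∑ i, (boostedKerrBilin (Λ i (x 0)) (E4.ofTimeSpace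 (x 0) (ξ i (x 0))) (M i) (a i) x - Minkowski.bilin), fun x ↦ x 0, E4.spatialNorm⟩ : ModelBackground) Φ x) t c R μ - ∑ j ∈ A, LandauLifshitz.quasiLocalMomentum (fun x : E4 ↦ (Minkowski.bilin + ∑ i, (boostedKerrBilin (Λ i (x 0)) (E4.ofTimeSpace (x 0) (ξ i (x 0))) (M i) (a i) x - Minkowski.bilin)) + 𝒟.toSpacetime.deviationExtend (⟨U, fun x ↦ Minkowski.bilin + ∑ i, (boostedKerrBilin (Λ i (x 0)) (E4.ofTimeSpace (x 0) (ξ i (x 0))) (M i) (a i) x - Minkowski.bilin), fun x ↦ x 0, E4.spatialNorm⟩ : ModelBackground) Φ x) t (ξ j t) (ρ j) μ| ≤ C * (R⁻¹ + ∑ j ∈ A, (ρ j)⁻¹) + ζ t)) := by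
  sorry

/-- **S4 — SOFT FINAL-MOTION LEMMA IN CHARGE FORM ⇒ CESÀRO VELOCITIES (Mathlib-only real analysis; LEAD'S STUB).**
An "expanding system of charges": `N` smooth centres in the cone `‖ξᵢ‖ ≤ κ²t`, pairwise separating, slaved
(`ξ̇ᵢ − vᵢ → 0`) to continuous velocities with `‖vᵢ‖ ≤ k < 1` eventually, and abstract charges `P` obeying the WINDOW
LAW (for every `δ`: `|ΔP| ≤ C∫(R⁻² + R^{-7/4}) + η(t₁)` along 2-Lipschitz paths of δ-admissible windows, `η → 0`) and
IDENTIFICATION (single-hole spheres carry `Mᵢγ(vᵢ)(1,vᵢ) ± (ζ + C/R)`; additivity on windows) — then every `ξᵢ(t)/t`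
converges. Plan: (0) eliminate `P`: along an admissible path the inside set `A` is constant (continuity across the
`[(1−δ)R, (1+δ)R]` gap), so the kinematic charge `Q_A = Σ_{j∈A} Mⱼγⱼ(1,vⱼ)` obeys the same law up to
`o(1) + C(1/R + 1/D_min)`; (1) `N = 1` / scale-`t`-isolated holes: window `c = ξᵢ`, `R = (κ−κ²)t/4`, budget
`∫(t⁻² + t^{-7/4}) < ∞` ⇒ `Mγ(v)(1,v)` Cauchy ⇒ `v` converges ⇒ `ξ/t` converges; (2) pairs at sublinear distance `d`:
per-hole windows `R = d/3` give the impulse bound `|Δv| ≲ ∫d^{-7/4} + η`, exponent `p = 7/4 > 1`, and the CROSSING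
LEMMA (`Negative.no_crossing_of_abs_deriv2_le`, slack-tolerant form) makes each coordinate of `(ξᵢ − ξⱼ)/t` converge
while the pair's total charge converges at scale `t`; (3) general `N`: induction over δ-clear scales (N centres block at
most N factor-4 ranges of radii; a window clean with margin stays clean for time `≍ δR` by the 2-Lipschitz bound),
fast encounters transfer `≲ d^{-3/4}/u → 0`, persistent partners share their Cesàro velocity. The §C/§G kinematic witness
is not a counterexample (its isolated window at `R = c₀t` carries a non-Cauchy charge). [size L] -/
theorem stub_expandingChargeKinematics :
    ∀ (N : ℕ) (M : Fin N → ℝ) (ξ v : Fin N → ℝ → E3) (κ : ℝ) (P : ℝ → E3 → ℝ → Fin 4 → ℝ),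
      (∀ i, 0 < M i) → 0 < κ → κ < 1 → (∀ i, ContDiff ℝ ((⊤ : ℕ∞) : WithTop ℕ∞) (ξ i)) →
      (∀ i, ∀ᶠ t in atTop, ‖ξ i t‖ ≤ κ ^ 2 * t) →
      (∀ i j, i ≠ j → Tendsto (fun t ↦ ‖ξ i t - ξ j t‖) atTop atTop) →
      (∀ i, Continuous (v i)) → (∃ k : ℝ, 0 ≤ k ∧ k < 1 ∧ ∀ i, ∀ᶠ t in atTop, ‖v i t‖ ≤ k) →
      (∀ i, Tendsto (fun t ↦ deriv (ξ i) t - v i t) atTop (𝓝 0)) →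
      (∀ δ : ℝ, 0 < δ → δ < 1 → ∃ (C R₀ T : ℝ) (η : ℝ → ℝ), Tendsto η atTop (𝓝 0) ∧ ∀ (t₁ t₂ : ℝ) (c : ℝ → E3) (R : ℝ → ℝ), T ≤ t₁ → t₁ ≤ t₂ → (∀ s ∈ Set.Icc t₁ t₂, ∀ s' ∈ Set.Icc t₁ t₂, ‖c s - c s'‖ ≤ 2 * |s - s'| ∧ |R s - R s'| ≤ 2 * |s - s'|) → (∀ s ∈ Set.Icc t₁ t₂, (R₀ ≤ R s ∧ ‖c s‖ + R s ≤ (κ + κ ^ 2) / 2 * s ∧ ∀ j, ‖ξ j s - c s‖ ≤ (1 - δ) * R s ∨ (1 + δ) * R s ≤ ‖ξ j s - c s‖)) → ∀ μ : Fin 4, |P t₂ (c t₂) (R t₂) μ - P t₁ (c t₁) (R t₁) μ| ≤ C * (∫ s in t₁..t₂, ((R s) ^ 2)⁻¹ + ((R s) ^ (7 / 4 : ℝ))⁻¹) + η t₁) →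
      (∃ (C R₀ T : ℝ) (ζ : ℝ → ℝ), Tendsto ζ atTop (𝓝 0) ∧ (∀ (t : ℝ) (i : Fin N) (R : ℝ), T ≤ t → R₀ ≤ R → ‖ξ i t‖ + R ≤ (κ + κ ^ 2) / 2 * t → (∀ j, j ≠ i → 3 * R ≤ ‖ξ i t - ξ j t‖) → |P t (ξ i t) R 0 - M i * (√(1 - ‖v i t‖ ^ 2))⁻¹| ≤ ζ t + C / R ∧ ∀ k : Fin 3, |P t (ξ i t) R k.succ - M i * (√(1 - ‖v i t‖ ^ 2))⁻¹ * v i t k| ≤ ζ t + C / R) ∧ (∀ (t : ℝ) (c : E3) (R : ℝ) (A : Finset (Fin N)) (ρ : Fin N → ℝ), T ≤ t → R₀ ≤ R → ‖c‖ + R ≤ (κ + κ ^ 2) / 2 * t → (∀ j ∈ A, ‖ξ j t - c‖ ≤ R / 2) → (∀ j ∉ A, 2 * R ≤ ‖ξ j t - c‖) → (∀ j ∈ A, R₀ ≤ ρ j ∧ ρ j ≤ R / 4 ∧ ∀ j', j' ≠ j → 3 * ρ j ≤ ‖ξ j t - ξ j' t‖) → ∀ μ : Fin 4, |P t c R μ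 - ∑ j ∈ A, P t (ξ j t) (ρ j) μ| ≤ C * (R⁻¹ + ∑ j ∈ A, (ρ j)⁻¹) + ζ t)) →
      ∀ i : Fin N, ∃ V : E3, Tendsto (fun t : ℝ ↦ t⁻¹ • ξ i t) atTop (𝓝 V) := by
  sorry

/-- **S5 — CESÀRO RE-CHARTING (shared transfer; verbatim `CesaroRecharting` of `Cruxes/InertialRecession/Sketch.lean`,
ideator 2; the sibling line's `stub_rechart` is the same move with `Slaved` pulled out as an input).** The crux with the
extra hypothesis "every painted centre has a Cesàro velocity `t⁻¹ξᵢ(t) → Vᵢ`": modulation-absorbing hole charts on the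
(mollified) actual motion + radial compression, flat domain following the actual centres with excision radii
`|ξᵢ − Vᵢt| + R′ + 1 = o(t)`, `τ₀`-shift and one push-up as in Disproof §B / `Theorems.inertialRecession_noHoles`; it must
re-derive adiabaticity `λ̇_⊥ → 0` internally (constraint equations, as S3b). DECLARED RISK (prover seat 0, item evidence
`InertialRecession_transfer_obstruction.md`, 2026-08-16): for a MOVING hole the conclusion certifies mixed (tilted) slabs
while the antecedent's exhaustion clause (vii) speaks of lab slabs; the transfer needs causal convexity of `Φ(U_late)` in
the MGHD / push-up (`LorentzianMetric.chronologicalFuture_causalFuture`, O'Neill 1983 Cor. 14.1, unproved in the tree) —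
a worker meeting this reports `stub-blocked` on that named fact or `stub-misstated` with the repaired clause. [size L/XL] -/
theorem stub_cesaroRecharting :
    open Literature.Geometry.Lorentzian in ∀ (X : Type) [TopologicalSpace X] [ChartedSpace E3 X] [IsManifold (𝓡 3) ((⊤ : ℕ∞) : WithTop ℕ∞) X] [T2Space X] [SecondCountableTopology X] [ConnectedSpace X], ∀ D ∈ admissibleVacuumData X, ∀ 𝒟 : VacuumCauchyDevelopment D, 𝒟.IsMaximal → ∀ (N : ℕ) (M a rin : Fin N → ℝ) (Λ : Fin N → ℝ → lorentzGroup) (ξ : Fin N → ℝ → E3) (γ κ τ₀ : ℝ) (U : Opens E4) (Φ : U → 𝒟.carrier) (O : Set 𝒟.carrier), ((∀ i, Kerr.IsSubextremal (M i) (a i) ∧ Kerr.rMinus (M i) (a i) < rin i ∧ rin i < Kerr.rPlus (M i) (a i)) ∧ (∀ i t, |((Λ i t : E4 ≃L[ℝ] E4) (E4.basisVector 0)) 0| ≤ γ) ∧ (∀ i, ContDiff ℝ ((⊤ : ℕ∞) : WithTop ℕ∞) (ξ i) ∧ ContDiff ℝ ((⊤ : ℕ∞) : WithTop ℕ∞)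 (fun t ↦ ((Λ i t : E4 ≃L[ℝ] E4) : E4 →L[ℝ] E4))) ∧ (∀ i j, i ≠ j → Tendsto (fun t ↦ ‖ξ i t - ξ j t‖) atTop atTop) ∧ (0 < κ ∧ κ < 1 ∧ ∀ i, ∀ᶠ t in atTop, ‖ξ i t‖ ≤ κ ^ 2 * t) ∧ ({x : E4 | τ₀ < x 0 ∧ ∀ i, rin i < Kerr.radius (a i) (poincareInv (Λ i (x 0)) (E4.ofTimeSpace (x 0) (ξ i (x 0))) x)} ⊆ (U : Set E4)) ∧ let B : ModelBackground := ⟨U, fun x ↦ Minkowski.bilin + ∑ i, (boostedKerrBilin (Λ i (x 0)) (E4.ofTimeSpace (x 0) (ξ i (x 0))) (M i) (a i) x - Minkowski.bilin), fun x ↦ x 0, E4.spatialNorm⟩; ContMDiff 𝓘(ℝ, E4) (𝓡 4) ((⊤ : ℕ∞) : WithTop ℕ∞) Φ ∧ Topology.IsOpenEmbedding ((B.lateRegion τ₀).restrict Φ) ∧ Φ '' {x : U | τ₀ < x.1 0 ∧ ∀ i, Kerr.rPlus (M i) (a i) < Kerr.radius (a i) (poincareInv (Λ i (x.1 0)) (E4.ofTimeSpace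 (x.1 0) (ξ i (x.1 0))) x.1)} ⊆ O ∧ Tendsto (fun t ↦ 𝒟.toSpacetime.deviationCk B Φ 3 t) atTop (𝓝 0) ∧ Tendsto (fun t : ℝ ↦ ⨆ x ∈ {x : U | x.1 0 = t ∧ E4.spatialNorm x.1 ≤ κ * t}, ⨆ (m : ℕ) (_ : m ≤ 3), ENNReal.ofReal (1 + √(√((⨅ i, ‖E4.spatial x.1 - ξ i t‖) ^ 7))) * ‖iteratedFDeriv ℝ m (𝒟.toSpacetime.deviationExtend B Φ) x.1‖ₑ) atTop (𝓝 0) ∧ O = Summit.FinalStateConjecture.exteriorOf 𝒟.toCauchyDevelopment (Φ '' {x : U | τ₀ < x.1 0 ∧ ∀ i, Kerr.rPlus (M i) (a i) < Kerr.radius (a i) (poincareInv (Λ i (x.1 0)) (E4.ofTimeSpace (x.1 0) (ξ i (x.1 0))) x.1)}) ∧ ∀ t₁ : ℝ, τ₀ < t₁ → O \ Φ '' {x : U | t₁ < x.1 0 ∧ ∀ i, Kerr.rPlus (M i) (a i) < Kerr.radius (a i) (poincareInv (Λ i (x.1 0)) (E4.ofTimeSpace (x.1 0) (ξ i (x.1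 0))) x.1)} ⊆ 𝒟.metric.causalPast 𝒟.timeOrientation (Φ '' {x : U | x.1 0 = t₁ ∧ ∀ i, Kerr.rPlus (M i) (a i) < Kerr.radius (a i) (poincareInv (Λ i (x.1 0)) (E4.ofTimeSpace (x.1 0) (ξ i (x.1 0))) x.1)})) → (∀ i : Fin N, ∃ V : E3, Tendsto (fun t : ℝ ↦ t⁻¹ • ξ i t) atTop (𝓝 V)) → ∃ (O : Set 𝒟.carrier) (d : FinalStateDecomposition 𝒟.toSpacetime O 2), (∀ i, Kerr.IsSubextremal (d.mass i) (d.spin i)) ∧ O = Summit.FinalStateConjecture.exteriorOf 𝒟.toCauchyDevelopment d.charted ∧ Summit.FinalStateConjecture.HasExhaustiveCharts d := by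
  sorry

/-! ## The composition (kernel-checked; concludes the crux BY NAME) -/

/-- **COMPOSITION.** `InertialRecession` from the six stubs BY NAME (pure logic): antecedent ⟹(S1) curvature luminosity
⟹(S2) window law for the LL charges of the lab metric; antecedent ⟹(S3a) kinematics of the painted velocities,
⟹(S3b) slaving + identification; (S4, with the kinematic clauses of the antecedent) every `ξᵢ(t)/t` converges;
(S5) re-charting yields the conclusion. Every `sorry` lives in a `stub_*`. -/
theorem InertialRecession_of :
    Summit.FinalStateConjecture.FinalStateConjecture.Theses.EIHFluxBalance.InertialRecession := by
  intro X _ _ _ _ _ _ D hD 𝒟 h𝒟 hyp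
  obtain ⟨N, M, a, rin, Λ, ξ, γ, κ, τ₀, U, Φ, O, hbig⟩ := hyp
  -- kinematic clauses of the antecedent consumed by S4
  have hM : ∀ i, 0 < M i := fun i ↦ (abs_nonneg (a i)).trans_lt (hbig.1 i).1
  have hκ : 0 < κ ∧ κ < 1 ∧ ∀ i, ∀ᶠ t in atTop, ‖ξ i t‖ ≤ κ ^ 2 * t := hbig.2.2.2.2.1
  have hsep : ∀ i j, i ≠ j → Tendsto (fun t ↦ ‖ξ i t - ξ j t‖) atTop atTop := hbig.2.2.2.1
  have hsmooth : ∀ i, ContDiff ℝ ((⊤ : ℕ∞) : WithTop ℕ∞) (ξ i) := fun i ↦ (hbig.2.2.1 i).1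
  -- the line
  have hL := stub_coneTransportLuminosity X D hD 𝒟 h𝒟 N M a rin Λ ξ γ κ τ₀ U Φ O hbig
  have hW := stub_windowFluxLaw X D hD 𝒟 h𝒟 N M a rin Λ ξ γ κ τ₀ U Φ O hbig hL
  obtain ⟨hcont, hk⟩ := stub_paintedVelocityKinematics X D hD 𝒟 h𝒟 N M a rin Λ ξ γ κ τ₀ U Φ O hbig
  obtain ⟨hslave, hI⟩ := stub_slavingChargeIdentification X D hD 𝒟 h𝒟 N M a rin Λ ξ γ κ τ₀ U Φ O hbig
  have hC := stub_expandingChargeKinematics N M ξ _ κ _ hM hκ.1 hκ.2.1 hsmooth hκ.2.2 hsep hcont hk hslave hW hI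
  exact stub_cesaroRecharting X D hD 𝒟 h𝒟 N M a rin Λ ξ γ κ τ₀ U Φ O hbig hC

/-! ## Kernel checks against the landed Negative lemmas (documentation; no stubs involved) -/

section NegativeChecks

open Summit.FinalStateConjecture.FinalStateConjecture.Theorems.InertialRecession.Negative

/-- The stabiliser twist of `PaintingRigidityStabiliser` fixes `e₀`, so the painted lab velocity — the only way boosts
enter S3a/S3b/S4 — is twist-invariant: `(Λ·R_θ) e₀ = Λ e₀`. -/
example (Λ : lorentzGroup) (θ : ℝ) :
    ((Λ * rotL θ : lorentzGroup) : E4 ≃L[ℝ] E4) (E4.basisVector 0) = (Λ : E4 ≃L[ℝ] E4) (E4.basisVector 0) := by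
  rw [mul_rotL_apply, rotCLM_basisVector_zero]

/-- The kinematic witness of `KinematicShadow` is not frozen and (§G) not even Cesàro; S4 derives Cesàro velocities from
the window law + identification it is handed, never from kinematics. -/
example : ¬ InertialRecessionWithoutFieldEquations := inertialRecession_false_without_fieldEquations

example : ¬ InertialRecessionWithoutFieldEquationsCesaro := inertialRecession_false_without_fieldEquations_cesaro

end NegativeChecks

end Summit.FinalStateConjecture.FinalStateConjecture.Cruxes.InertialRecession.OldLightLeavesTheCone

end
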